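import Summits.KontsevichZagierPeriods.KontsevichZagierPeriods.Theses.SymplecticScissors
import Literature.NumberTheory.Transcendental.KZKernelConjectureForms
import Literature.NumberTheory.Transcendental.KZCalculusProofs

/-!
# `PlanarAreas` (stmt-KontsevichZagierPeriods-4990): negative side — I. shape of any refutation, load-bearing hypotheses

Negative-side support for the crux `PlanarAreas` (shared verbatim by routes LowDimension r3,
HodgeLevel r4, SymplecticScissors r5; cdisprove unit, refuter seats
`refuter-cdisprove-stmt-KontsevichZagierPeriods-4990-*`; running commentary in the work file
`Cruxes/PlanarAreas/Disproof.lean`).  The crux: two `ℚ`-semialgebraic planar sets of (finite) equal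
area, as integrand-`1` representations `r r' : KZ.IntegralRep 2`, are `KZ.Equivalent` — connected by
the four moves of `KZCalculus.lean` through any dimension.  NOTHING HERE REFUTES IT: the crux is an
instance of the summit (`of_summit`, integrand `1` is KZ-literal data `p = q = 1`), so a refutation
is a counterexample to Conjecture 1 as formalised and must be an additive invariant of
`KZ.FormalRep` vanishing on the four move sets and finer than the area
(`not_of_separating_invariant`).

* §0 `crux_iff` (read-back, `Iff.rfl`);
* §1 shape: `of_summit`, `not_summit_of_not`, `of_kzKernelConjecture`, `of_volumeForm`,
  `of_planarK0Injective` (modulo the route support `GroupToAreas`), `not_of_separating_invariant`;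
* §2 the test regions `[(0,1)², 1]`, `[[0,1]², 1]` (`constOneRep`) and the LOAD-BEARING ANALYSIS:
  `not_withoutValue` (drop `r.value = r'.value`: false by soundness), while dropping
  "integrand `= 1`" (`withoutIntegrandOne_of_summit`) or "dimension `2`" (`volumeForm_of_summit`)
  still follows from the summit — those hypotheses are scope, not load.

Companion files in this directory: `Strengthenings.lean` (no-null-set Monge form and
additivity-only chains refuted), `Normalisations.lean` (area-`0` slice proved, WLOG open domains),
`WindowInvariant.lean`, `WindowDefect.lean`, `Rule2LoadBearing.lean` (rule 2 is load-bearing: the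
change-of-variables-free sub-calculus does not prove the crux).

Sources: M. Kontsevich, D. Zagier, *Periods* (2001), §§1.1–1.2; J. Cresson, J. Viu-Sos, JTNB 34
(2022), §1 (volume form of Conjecture 1); A. Huber, G. Wüstholz, *Transcendence and linear
relations of 1-periods* (2022), Thm. 13.3.

REPAIR 2026-08-19 (cell pub-kz1p, seat b2b-kz1p-1; ONE identifier removed from an `open … (…)` list, NO statement,
proof or declaration changed): the explicit open list below named `PlanarTransport`, which the items-cap lint autofix of
2026-08-16T14:16:23Z dropped from `Theses/SymplecticScissors.lean` (the identifier is not used in this file); with it the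
module no longer elaborated at HEAD (`Unknown constant ….Theses.SymplecticScissors.PlanarTransport`) while its pre-drop
olean kept being served, so nothing downstream (`Normalisations` → `StubElementaryMoves*` → `SymplecticScissorsPlanarCompiler`
→ `SymplecticScissorsPlanarTransport` → `KzOnePeriodsRungOneOfHW` / `KzOnePeriodsGaps`) could be rebuilt. -/

noncomputable section

open Set MeasureTheory MvPolynomial Filter Topology
open Literature.NumberTheory.Transcendental Literature.ModelTheory.ExponentialFields

namespace Summit.KontsevichZagierPeriods.PlanarAreas.Negative

open Summit.KontsevichZagierPeriods.KontsevichZagierPeriods.Theses.SymplecticScissors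
  (PlanarAreas VolumeForm PlanarK0Injective GroupToAreas)

/-! ## §0 Read-back -/

/-- The crux, unfolded (by `Iff.rfl`). -/
theorem crux_iff :
    PlanarAreas ↔ ∀ (r r' : KZ.IntegralRep 2), (∀ p ∈ r.domain, r.integrand p = 1) →
      (∀ p ∈ r'.domain, r'.integrand p = 1) → r.value = r'.value → KZ.Equivalent r r' :=
  Iff.rfl

/-! ## §1 Shape of any refutation -/

/-- An integrand-`1` representation has KZ's literal rational shape (`p = q = 1`). -/
theorem isRational_of_integrand_one {n : ℕ} {r : KZ.IntegralRep n}
    (h : ∀ p ∈ r.domain, r.integrand p = 1) : r.IsRational :=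
  ⟨1, 1, fun x _ => by simp, fun x hx => by simp [h x hx]⟩

/-- **The crux is an instance of the summit** (Conjecture 1 as formalised, `n = m = 2`,
integrands `1 = 1/1`). -/
theorem of_summit (h : _root_.KontsevichZagierPeriods) : PlanarAreas :=
  fun r r' hr hr' hv => h r r' (isRational_of_integrand_one hr) (isRational_of_integrand_one hr') hv

/-- Hence any disproof of the crux disproves the summit. -/
theorem not_summit_of_not (h : ¬ PlanarAreas) : ¬ _root_.KontsevichZagierPeriods :=
  mt of_summit h

/-- The crux from the kernel form `ker eval = relations`. -/
theorem of_kzKernelConjecture (h : KZKernelConjecture) : PlanarAreas :=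
  of_summit (kzKernelConjecture_iff_isRational.mp h)

/-- The crux is the layer `N = 2` of the route frame `VolumeForm`. -/
theorem of_volumeForm (h : VolumeForm) : PlanarAreas :=
  fun r r' hr hr' hv => h r r' hr hr' hv

/-- The group form `PlanarK0Injective` (crux 9847) implies the crux, given the route support
`GroupToAreas` (stmt-9851, planar set-chains are KZ chains: `AddSubgroup.closure_le` plus
`KZ.domainAddRel_subset_relations` / `KZ.changeOfVariablesRel_subset_relations`; a prover's item,
candidate proofs attached there, not re-proved by the refuter). -/
theorem of_planarK0Injective (hG : GroupToAreas) (h : PlanarK0Injective) : PlanarAreas :=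
  fun r r' hr hr' hv => hG r r' (h r r' hr hr' hv)

/-- TEMPLATE of a refutation: an additive invariant `J` vanishing on the four move sets which
separates two integrand-`1` planar representations of equal area.  (Soundness makes `eval` such
an invariant except for the last clause: `J` must see more than the area.) -/
theorem not_of_separating_invariant {A : Type*} [AddCommGroup A] (J : KZ.FormalRep →+ A)
    (hJ : ∀ x ∈ KZ.domainAddRel ∪ KZ.integrandAddRel ∪ KZ.changeOfVariablesRel ∪
      KZ.newtonLeibnizRel, J x = 0)
    (r r' : KZ.IntegralRep 2) (hr : ∀ p ∈ r.domain, r.integrand p = 1)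
    (hr' : ∀ p ∈ r'.domain, r'.integrand p = 1) (hv : r.value = r'.value)
    (hJr : J (KZ.of r) ≠ J (KZ.of r')) : ¬ PlanarAreas := by
  intro h
  have hker : KZ.relations ≤ J.ker := (AddSubgroup.closure_le _).mpr fun x hx => hJ x hx
  have := hker (h r r' hr hr' hv)
  rw [AddMonoidHom.mem_ker, map_sub, sub_eq_zero] at this
  exact hJr this

/-! ## §2 Load-bearing hypotheses -/

/-! ### Two test regions: the open and the closed unit square -/

/-- The open unit square `(0,1)²`. -/
def openSquareSet : Set (Fin 2 → ℝ) := {p | 0 < p 0 ∧ p 0 < 1 ∧ 0 < p 1 ∧ p 1 < 1}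

/-- The closed unit square `[0,1]²`. -/
def closedSquareSet : Set (Fin 2 → ℝ) := {p | 0 ≤ p 0 ∧ p 0 ≤ 1 ∧ 0 ≤ p 1 ∧ p 1 ≤ 1}

/-- The open square as a product of intervals. -/
theorem openSquareSet_eq_pi : openSquareSet = Set.pi univ fun _ : Fin 2 => Ioo (0:ℝ) 1 := by
  ext p
  simp [openSquareSet, Fin.forall_fin_two, and_assoc]

/-- The closed square as an order interval of `ℝ²`. -/
theorem closedSquareSet_eq_Icc : closedSquareSet = Icc (0 : Fin 2 → ℝ) 1 := by
  ext p
  simp only [closedSquareSet, mem_setOf_eq, mem_Icc, Pi.le_def, Fin.forall_fin_two,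
    Pi.zero_apply, Pi.one_apply]
  tauto

/-- The open unit square is `ℚ`-semialgebraic (four polynomial inequalities). -/
theorem isSemialgebraic_openSquareSet : IsSemialgebraic ℚ openSquareSet := by
  have h0 := isSemialgebraic_setOf_eval_lt (k := ℚ) (R := ℝ) (ι := Fin 2) (C 0) (X 0)
  have h1 := isSemialgebraic_setOf_eval_lt (k := ℚ) (R := ℝ) (ι := Fin 2) (X 0) (C 1)
  have h2 := isSemialgebraic_setOf_eval_lt (k := ℚ) (R := ℝ) (ι := Fin 2) (C 0) (X 1)
  have h3 := isSemialgebraic_setOf_eval_lt (k := ℚ) (R := ℝ) (ι := Fin 2) (X 1) (C 1)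
  have hEq : openSquareSet =
      {x : Fin 2 → ℝ | aeval x (C 0 : MvPolynomial (Fin 2) ℚ) < aeval x (X 0 : MvPolynomial (Fin 2) ℚ)} ∩
      ({x : Fin 2 → ℝ | aeval x (X 0 : MvPolynomial (Fin 2) ℚ) < aeval x (C 1 : MvPolynomial (Fin 2) ℚ)} ∩
      ({x : Fin 2 → ℝ | aeval x (C 0 : MvPolynomial (Fin 2) ℚ) < aeval x (X 1 : MvPolynomial (Fin 2) ℚ)} ∩
      {x : Fin 2 → ℝ | aeval x (X 1 : MvPolynomial (Fin 2) ℚ) < aeval x (C 1 : MvPolynomial (Fin 2) ℚ)})) := by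
    ext p
    simp [openSquareSet]
  rw [hEq]
  exact h0.inter (h1.inter (h2.inter h3))

/-- The closed unit square is `ℚ`-semialgebraic. -/
theorem isSemialgebraic_closedSquareSet : IsSemialgebraic ℚ closedSquareSet := by
  have h0 := isSemialgebraic_setOf_eval_le (k := ℚ) (R := ℝ) (ι := Fin 2) (C 0) (X 0)
  have h1 := isSemialgebraic_setOf_eval_le (k := ℚ) (R := ℝ) (ι := Fin 2) (X 0) (C 1)
  have h2 := isSemialgebraic_setOf_eval_le (k := ℚ) (R := ℝ) (ι := Fin 2) (C 0) (X 1)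
  have h3 := isSemialgebraic_setOf_eval_le (k := ℚ) (R := ℝ) (ι := Fin 2) (X 1) (C 1)
  have hEq : closedSquareSet =
      {x : Fin 2 → ℝ | aeval x (C 0 : MvPolynomial (Fin 2) ℚ) ≤ aeval x (X 0 : MvPolynomial (Fin 2) ℚ)} ∩
      ({x : Fin 2 → ℝ | aeval x (X 0 : MvPolynomial (Fin 2) ℚ) ≤ aeval x (C 1 : MvPolynomial (Fin 2) ℚ)} ∩
      ({x : Fin 2 → ℝ | aeval x (C 0 : MvPolynomial (Fin 2) ℚ) ≤ aeval x (X 1 : MvPolynomial (Fin 2) ℚ)} ∩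
      {x : Fin 2 → ℝ | aeval x (X 1 : MvPolynomial (Fin 2) ℚ) ≤ aeval x (C 1 : MvPolynomial (Fin 2) ℚ)})) := by
    ext p
    simp [closedSquareSet]
  rw [hEq]
  exact h0.inter (h1.inter (h2.inter h3))

/-- The open unit square has area `1`. -/
theorem volume_openSquareSet : volume openSquareSet = 1 := by
  rw [openSquareSet_eq_pi]
  have := Real.volume_pi_Ioo (a := fun _ : Fin 2 => (0:ℝ)) (b := fun _ => 1)
  simpa using this

/-- The closed unit square has area `1`. -/
theorem volume_closedSquareSet : volume closedSquareSet = 1 := by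
  rw [closedSquareSet_eq_Icc, Real.volume_Icc_pi]
  simp

/-- The open unit square is open. -/
theorem isOpen_openSquareSet : IsOpen openSquareSet := by
  rw [openSquareSet_eq_pi]
  exact isOpen_set_pi finite_univ fun _ _ => isOpen_Ioo

/-- The corner `0` lies in the closed square. -/
theorem zero_mem_closedSquareSet : (0 : Fin 2 → ℝ) ∈ closedSquareSet := by
  simp [closedSquareSet]

/-- The corner `0` does not lie in the open square. -/
theorem zero_not_mem_openSquareSet : (0 : Fin 2 → ℝ) ∉ openSquareSet := by
  simp [openSquareSet]

/-- The integrand-`1` representation on a `ℚ`-semialgebraic set of finite measure. -/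
def constOneRep (s : Set (Fin 2 → ℝ)) (hs : IsSemialgebraic ℚ s) (hfin : volume s ≠ ⊤) :
    KZ.IntegralRep 2 where
  domain := s
  integrand := fun _ => 1
  isSemialgebraic_domain := hs
  isSemialgebraicFunOn_integrand := by simpa using isSemialgebraicFunOn_natCast hs 1
  integrableOn := integrableOn_const hfin

/-- The domain of `constOneRep s`. -/
@[simp] theorem constOneRep_domain (s : Set (Fin 2 → ℝ)) (hs : IsSemialgebraic ℚ s)
    (hfin : volume s ≠ ⊤) : (constOneRep s hs hfin).domain = s := rfl

/-- The integrand of `constOneRep s` is the constant `1`. -/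
@[simp] theorem constOneRep_integrand (s : Set (Fin 2 → ℝ)) (hs : IsSemialgebraic ℚ s)
    (hfin : volume s ≠ ⊤) : (constOneRep s hs hfin).integrand = fun _ => 1 := rfl

/-- The value of `constOneRep s` is the area of `s`. -/
theorem value_constOneRep (s : Set (Fin 2 → ℝ)) (hs : IsSemialgebraic ℚ s)
    (hfin : volume s ≠ ⊤) : (constOneRep s hs hfin).value = (volume s).toReal := by
  show ∫ _ in s, (1:ℝ) = _
  rw [setIntegral_const, smul_eq_mul, mul_one, measureReal_def]

/-- `[(0,1)², 1]`. -/
def openSquare : KZ.IntegralRep 2 :=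
  constOneRep openSquareSet isSemialgebraic_openSquareSet (by simp [volume_openSquareSet])

/-- `[[0,1]², 1]`. -/
def closedSquare : KZ.IntegralRep 2 :=
  constOneRep closedSquareSet isSemialgebraic_closedSquareSet (by simp [volume_closedSquareSet])

/-- The domain of `openSquare`. -/
@[simp] theorem openSquare_domain : openSquare.domain = openSquareSet := rfl
/-- The domain of `closedSquare`. -/
@[simp] theorem closedSquare_domain : closedSquare.domain = closedSquareSet := rfl
/-- The integrand of `openSquare`. -/
@[simp] theorem openSquare_integrand : openSquare.integrand = fun _ => 1 := rfl
/-- The integrand of `closedSquare`. -/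
@[simp] theorem closedSquare_integrand : closedSquare.integrand = fun _ => 1 := rfl

/-- `[(0,1)², 1]` has value `1`. -/
theorem value_openSquare : openSquare.value = 1 := by
  rw [openSquare, value_constOneRep, volume_openSquareSet, ENNReal.toReal_one]

/-- `[[0,1]², 1]` has value `1`. -/
theorem value_closedSquare : closedSquare.value = 1 := by
  rw [closedSquare, value_constOneRep, volume_closedSquareSet, ENNReal.toReal_one]

/-! ### (H3) `r.value = r'.value` is load-bearing (trivially, by soundness) -/

/-- The crux with the hypothesis `r.value = r'.value` dropped. -/
def WithoutValue : Prop :=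
  ∀ (r r' : KZ.IntegralRep 2), (∀ p ∈ r.domain, r.integrand p = 1) →
    (∀ p ∈ r'.domain, r'.integrand p = 1) → KZ.Equivalent r r'

/-- Dropping the value hypothesis is false: `[∅]` (area `0`) and `[(0,1)²]` (area `1`) are not
equivalent, by soundness of the calculus (`KZ.Equivalent.value_eq_holds`). -/
theorem not_withoutValue : ¬ WithoutValue := by
  intro h
  have hE := h (KZ.IntegralRep.empty 2) openSquare (fun p hp => hp.elim) (fun _ _ => rfl)
  have := KZ.Equivalent.value_eq_holds hE
  rw [KZ.IntegralRep.value_empty, value_openSquare] at this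
  exact zero_ne_one this

/-! ### (H1)/(H2) "integrand = 1" and "dimension 2" are scope, not load -/

/-- The crux with the integrand-`1` hypotheses dropped: ALL planar representations. -/
def WithoutIntegrandOne : Prop :=
  ∀ (r r' : KZ.IntegralRep 2), r.value = r'.value → KZ.Equivalent r r'

/-- The crux is a special case of its integrand-free version. -/
theorem planarAreas_of_withoutIntegrandOne (h : WithoutIntegrandOne) : PlanarAreas :=
  fun r r' _ _ hv => h r r' hv

/-- Dropping "integrand = 1" still follows from the kernel conjecture … -/
theorem withoutIntegrandOne_of_kzKernelConjecture (h : KZKernelConjecture) : WithoutIntegrandOne :=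
  fun r r' hv => (kzKernelConjecture_iff_kzPeriodConjecture'.mp h) r r' hv

/-- … hence from the summit: the integrand-`1` hypotheses cannot be the reason the crux fails,
short of the summit failing. -/
theorem withoutIntegrandOne_of_summit (h : _root_.KontsevichZagierPeriods) : WithoutIntegrandOne :=
  withoutIntegrandOne_of_kzKernelConjecture (kzKernelConjecture_iff_isRational.mpr h)

/-- Dropping "dimension 2" (the frame `VolumeForm`, all `N`) also follows from the summit. -/
theorem volumeForm_of_summit (h : _root_.KontsevichZagierPeriods) : VolumeForm :=
  fun _ r r' hr hr' hv => h r r' (isRational_of_integrand_one hr) (isRational_of_integrand_one hr') hv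

end Summit.KontsevichZagierPeriods.PlanarAreas.Negative

end
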